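import Summits.NavierStokesRegularity.NavierStokesRegularity.Theses.RellichScar
import Literature.Analysis.FluidPDE.ScarNonuniquenessWitnesses
import Literature.Analysis.FluidPDE.PotentialFlowParabolicExterior
import Literature.Analysis.FluidPDE.DipoleMomentFlowParabolicExterior

/-!
# `ScarRigidity` (crux stmt-NavierStokesRegularity-11717, route RellichScar): logical position and
# load-bearing hypotheses — negative-side support (cdisprove seat, gen 2)

Sorry-free lemmas of the standing disprover of
`Summit.NavierStokesRegularity.NavierStokesRegularity.Theses.RellichScar.ScarRigidity` ("two singular apex
Type-I profiles on `ℝ³×(−∞,0)` with the same final-time trace off the origin coincide"), extracted from its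
work file `Cruxes/ScarRigidity/Disproof.lean` so that ideators, planners and provers can IMPORT them:

* §0 NORMAL FORM: `SameScar`, `AeEqSlab`, the fixed-constant slice `ScarRigidityAt C`;
  `scarRigidity_iff_forall_at`, `scarRigidity_iff_pos` (only `0 < C` carries content:
  `pos_const_of_apexSingular`), `scarRigidityAt_anti` (slices antitone in `C` — a threshold theorem
  `∀ C < C₀` is the crux on profiles of constant `< C₀`), `scarRigidity_twoConstants` (same `C` is WLOG);
* §1 LOGICAL POSITION: `scarRigidity_or_exists_singular_apex` — EITHER the crux holds OR a suitable weak
  solution on the slab with `𝐈 < ∞`, apex bound `C > 0` and a backward-singular origin exists (a Type-I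
  blow-up profile in the KNSS (1.6)/Albritton–Barker form; none is known): the crux is implied by the route
  target `NoApexTypeIProfile` and is irrefutable by explicit construction;
* §2 LOAD-BEARING HYPOTHESES, each as "the crux with the named hypotheses dropped is FALSE":
  `scarRigidity_false_without_navierStokes` (drop only the equations; keep gradients, `𝐈 < ∞`, apex bound,
  both singular origins — kinematic bump `±χ(|x|²/(−t))/√(−t)e₀`), `scarRigidity_false_rate_without_morrey`
  (keep Navier–Stokes and both singular origins, weaken the apex bound to the rate, drop `𝐈 < ∞` — parasitic
  drifts, KNSS 2009 §1), `scarRigidity_false_without_decay` (LYY 2024 Ex. 1.2), `scarRigidity_false_local`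
  (every cylinder `Q_R(0,0)`), `scarRigidity_false_parabolicExterior` (every `R ≥ 1`, EVERY `C > 0`: Serrin
  potential flow `C√(−t)∇Γ`), `scarRigidity_false_parabolicExterior_cubicDecay` (even with
  `‖u‖ ≤ C(−t)/(π‖x‖³)`: dipole-moment flow) — the witnesses are the Literature files
  `ScarNonuniquenessWitnesses`, `UniformDriftBackwardNonuniqueness`, `PotentialFlowParabolicExterior`,
  `DipoleMomentFlowParabolicExterior`.

Summary for provers: a proof must use the equations, decay at SPATIAL infinity on whole slices (not merely
the rate or the singularity), globality in space, and the equations across the parabolic core down to the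
apex axis (no decay-rate hypothesis replaces them); dropping the singularity hypotheses instead gives TRUE
statements (Lei–Yang–Yuan 2024 Thm 1.1 + mildness from decay; not in tree).

## References

* G. Koch, N. Nadirashvili, G. Seregin, V. Šverák, Acta Math. 203 (2009), §1 (parasitic solutions; (1.6)). [KNSS2009]
* Z. Lei, Z. Yang, C. Yuan, IMRN (2024) = arXiv:2311.02429, Thm 1.1, Example 1.2. [LeiYangYuan2024]
* J. Serrin, Arch. Rational Mech. Anal. 9 (1962) 187–195 (potential flows `a(t)∇h`). [Serrin1962]
* D. Albritton, T. Barker, J. Math. Fluid Mech. 21 (2019) = arXiv:1811.00502, §1, Thm 1.1. [AlbrittonBarker2019]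
-/

noncomputable section

open Set Filter Function MeasureTheory Metric TopologicalSpace
open scoped Topology ENNReal NNReal InnerProductSpace RealInnerProductSpace
open Literature.Analysis.FluidPDE
open Summit.NavierStokesRegularity.NavierStokesRegularity.Theses.RellichScar

set_option linter.dupNamespace false

namespace Summit.NavierStokesRegularity.NavierStokesRegularity.Theorems.ScarRigidity.Negative

/-- Physical space. -/
local notation "ℝ³" => EuclideanSpace ℝ (Fin 3)

/-- The open backward slab `(-∞,0) × ℝ³` (time first), as in the route file. -/
local notation "𝕊" => Literature.Analysis.FluidPDE.slab (EuclideanSpace ℝ (Fin 3)) (Set.Iio (0 : ℝ)) isOpen_Iio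

/-! ## §0 Normal form -/

/-- SAME SCAR (verbatim the hypothesis of the crux): `ess sup_{(−δ,0)×K} ‖u₁ − u₂‖ → 0` as `δ ↓ 0`
for every compact `K ∌ 0`. -/
def SameScar (u₁ u₂ : ℝ → ℝ³ → ℝ³) : Prop :=
  ∀ K : Set ℝ³, IsCompact K → (0 : ℝ³) ∉ K →
    Tendsto (fun δ : ℝ => eLpNorm (uncurry u₁ - uncurry u₂) ⊤
      (volume.restrict (Ioo (-δ) 0 ×ˢ K))) (𝓝[>] 0) (𝓝 0)

/-- The conclusion of the crux: a.e. equality on the slab. -/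
def AeEqSlab (u₁ u₂ : ℝ → ℝ³ → ℝ³) : Prop :=
  uncurry u₁ =ᵐ[volume.restrict (Iio (0 : ℝ) ×ˢ (univ : Set ℝ³))] uncurry u₂

/-- The crux at a FIXED Type-I constant `C` (all other binders verbatim). -/
def ScarRigidityAt (C : ℝ) : Prop :=
  ∀ (u₁ : ℝ → ℝ³ → ℝ³) (p₁ : ℝ → ℝ³ → ℝ) (G₁ : ℝ → ℝ³ → ℝ³ →L[ℝ] ℝ³)
    (u₂ : ℝ → ℝ³ → ℝ³) (p₂ : ℝ → ℝ³ → ℝ) (G₂ : ℝ → ℝ³ → ℝ³ →L[ℝ] ℝ³),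
    IsSuitableWeakSolutionOn 𝕊 1 0 u₁ p₁ → HasWeakSpatialGradientOn 𝕊 u₁ G₁ →
    typeIBound (Iio (0 : ℝ) ×ˢ univ) u₁ p₁ G₁ < ⊤ → HasTypeIDecay C u₁ →
    IsSuitableWeakSolutionOn 𝕊 1 0 u₂ p₂ → HasWeakSpatialGradientOn 𝕊 u₂ G₂ →
    typeIBound (Iio (0 : ℝ) ×ˢ univ) u₂ p₂ G₂ < ⊤ → HasTypeIDecay C u₂ →
    IsBackwardSingularPoint u₁ 0 → IsBackwardSingularPoint u₂ 0 →
    SameScar u₁ u₂ → AeEqSlab u₁ u₂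

/-- `ScarRigidity ↔ ∀ C, ScarRigidityAt C` (the crux binds `C` last; pure binder shuffling). -/
theorem scarRigidity_iff_forall_at : ScarRigidity ↔ ∀ C : ℝ, ScarRigidityAt C :=
  ⟨fun h C u₁ p₁ G₁ u₂ p₂ G₂ => h u₁ p₁ G₁ u₂ p₂ G₂ C,
    fun h u₁ p₁ G₁ u₂ p₂ G₂ C => h C u₁ p₁ G₁ u₂ p₂ G₂⟩

/-- A function vanishing on the open past slab has `ess sup = 0 ≠ ∞` on `Q_1(0,0)`, so the origin is
NOT backward-singular for it. [folklore] -/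
theorem not_isBackwardSingularPoint_of_eq_zero {u : ℝ → ℝ³ → ℝ³} (h : ∀ t < 0, ∀ x, u t x = 0) :
    ¬ IsBackwardSingularPoint u 0 := by
  intro hs
  have h1 := hs 1 one_pos
  have hae : uncurry u =ᵐ[volume.restrict (parabolicCylinder 1 (0 : ℝ × ℝ³))] 0 := by
    filter_upwards [ae_restrict_mem (isOpen_parabolicCylinder 1 (0 : ℝ × ℝ³)).measurableSet] with z hz
    rw [mem_parabolicCylinder] at hz
    have ht : z.1 < 0 := by simpa using hz.1.2
    simp [uncurry, h z.1 ht z.2]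
  rw [eLpNorm_congr_ae hae, eLpNorm_zero] at h1
  exact ENNReal.zero_ne_top h1

/-- DEGENERATE CONSTANTS: the Type-I constant of a backward-singular apex profile is POSITIVE
(`C ≤ 0` forces `u = 0` on `t < 0`, which is not singular).  Hence only the slices `0 < C` of the crux
carry content. [folklore] -/
theorem pos_const_of_apexSingular {C : ℝ} {u : ℝ → ℝ³ → ℝ³} (hd : HasTypeIDecay C u)
    (hs : IsBackwardSingularPoint u 0) : 0 < C := by
  by_contra hC
  have hC : C ≤ 0 := not_lt.1 hC
  refine not_isBackwardSingularPoint_of_eq_zero (fun t ht x => ?_) hs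
  have hden : 0 < ‖x‖ + Real.sqrt (-t) :=
    add_pos_of_nonneg_of_pos (norm_nonneg _) (Real.sqrt_pos.2 (by linarith))
  have := hd t ht x
  have hle : C / (‖x‖ + Real.sqrt (-t)) ≤ 0 := div_nonpos_of_nonpos_of_nonneg hC hden.le
  exact norm_le_zero_iff.1 (this.trans hle)

/-- The `C ≤ 0` slices of the crux hold (vacuously). -/
theorem scarRigidityAt_of_nonpos {C : ℝ} (hC : C ≤ 0) : ScarRigidityAt C := by
  intro u₁ p₁ G₁ u₂ p₂ G₂ _ _ _ hd₁ _ _ _ _ hs₁ _ _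
  exact absurd (pos_const_of_apexSingular hd₁ hs₁) (not_lt.2 hC)

/-- NORMAL FORM: the crux is its family of positive-constant slices. -/
theorem scarRigidity_iff_pos : ScarRigidity ↔ ∀ C : ℝ, 0 < C → ScarRigidityAt C := by
  rw [scarRigidity_iff_forall_at]
  refine ⟨fun h C _ => h C, fun h C => ?_⟩
  rcases le_or_gt C 0 with hC | hC
  · exact scarRigidityAt_of_nonpos hC
  · exact h C hC

/-- Monotonicity of the apex bound in the constant. [folklore] -/
theorem hasTypeIDecay_mono {C C' : ℝ} (hCC' : C ≤ C') {u : ℝ → ℝ³ → ℝ³} (h : HasTypeIDecay C u) :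
    HasTypeIDecay C' u := fun t ht x => by
  refine (h t ht x).trans (div_le_div_of_nonneg_right hCC' ?_)
  exact (add_pos_of_nonneg_of_pos (norm_nonneg _) (Real.sqrt_pos.2 (by linarith))).le

/-- The slices are ANTITONE in `C` (a larger constant is a larger class): a threshold theorem
`∀ C < C₀, ScarRigidityAt C` is exactly the crux restricted to profiles of Type-I constant `< C₀`. -/
theorem scarRigidityAt_anti {C C' : ℝ} (hCC' : C ≤ C') (h : ScarRigidityAt C') : ScarRigidityAt C := by
  intro u₁ p₁ G₁ u₂ p₂ G₂ hs₁ hg₁ hI₁ hd₁ hs₂ hg₂ hI₂ hd₂ hsing₁ hsing₂ hscar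
  exact h u₁ p₁ G₁ u₂ p₂ G₂ hs₁ hg₁ hI₁ (hasTypeIDecay_mono hCC' hd₁) hs₂ hg₂ hI₂
    (hasTypeIDecay_mono hCC' hd₂) hsing₁ hsing₂ hscar

/-- SAME-`C` IS WLOG: the crux implies its two-constant form (weaken both to `max C₁ C₂`). -/
theorem scarRigidity_twoConstants (h : ScarRigidity) :
    ∀ (u₁ : ℝ → ℝ³ → ℝ³) (p₁ : ℝ → ℝ³ → ℝ) (G₁ : ℝ → ℝ³ → ℝ³ →L[ℝ] ℝ³)
      (u₂ : ℝ → ℝ³ → ℝ³) (p₂ : ℝ → ℝ³ → ℝ) (G₂ : ℝ → ℝ³ → ℝ³ →L[ℝ] ℝ³) (C₁ C₂ : ℝ),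
      IsSuitableWeakSolutionOn 𝕊 1 0 u₁ p₁ → HasWeakSpatialGradientOn 𝕊 u₁ G₁ →
      typeIBound (Iio (0 : ℝ) ×ˢ univ) u₁ p₁ G₁ < ⊤ → HasTypeIDecay C₁ u₁ →
      IsSuitableWeakSolutionOn 𝕊 1 0 u₂ p₂ → HasWeakSpatialGradientOn 𝕊 u₂ G₂ →
      typeIBound (Iio (0 : ℝ) ×ˢ univ) u₂ p₂ G₂ < ⊤ → HasTypeIDecay C₂ u₂ →
      IsBackwardSingularPoint u₁ 0 → IsBackwardSingularPoint u₂ 0 →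
      SameScar u₁ u₂ → AeEqSlab u₁ u₂ := by
  intro u₁ p₁ G₁ u₂ p₂ G₂ C₁ C₂ hs₁ hg₁ hI₁ hd₁ hs₂ hg₂ hI₂ hd₂ hsing₁ hsing₂ hscar
  exact h u₁ p₁ G₁ u₂ p₂ G₂ (max C₁ C₂) hs₁ hg₁ hI₁ (hasTypeIDecay_mono (le_max_left _ _) hd₁) hs₂ hg₂ hI₂
    (hasTypeIDecay_mono (le_max_right _ _) hd₂) hsing₁ hsing₂ hscar

/-! ## §1 Logical position -/

/-- **EITHER the crux OR a Type-I blow-up profile.**  If `ScarRigidity` fails then its hypotheses are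
inhabited: a suitable weak solution of Navier–Stokes on `ℝ³ × (−∞,0)` with `𝐈 < ∞`, the apex bound with a
constant `C > 0` and a backward-singular origin exists — the open heart of the summit (KNSS (1.6) /
Albritton–Barker 2019 Thm 1.1).  Equivalently the route target `NoApexTypeIProfile` implies the crux. -/
theorem scarRigidity_or_exists_singular_apex :
    ScarRigidity ∨
      ∃ (C : ℝ) (u : ℝ → ℝ³ → ℝ³) (p : ℝ → ℝ³ → ℝ) (G : ℝ → ℝ³ → ℝ³ →L[ℝ] ℝ³), 0 < C ∧
        IsSuitableWeakSolutionOn 𝕊 1 0 u p ∧ HasWeakSpatialGradientOn 𝕊 u G ∧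
        typeIBound (Iio (0 : ℝ) ×ˢ univ) u p G < ⊤ ∧ HasTypeIDecay C u ∧ IsBackwardSingularPoint u 0 := by
  by_contra h
  rw [not_or] at h
  refine h.1 fun u₁ p₁ G₁ u₂ p₂ G₂ C hs₁ hg₁ hI₁ hd₁ _ _ _ _ hsing₁ _ _ => ?_
  exact absurd ⟨C, u₁, p₁, G₁, pos_const_of_apexSingular hd₁ hsing₁, hs₁, hg₁, hI₁, hd₁, hsing₁⟩ h.2

/-- ¬CRUX ⇒ a singular apex Type-I profile with `C > 0` exists. -/
theorem exists_singular_apex_of_not_scarRigidity (h : ¬ ScarRigidity) :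
    ∃ (C : ℝ) (u : ℝ → ℝ³ → ℝ³) (p : ℝ → ℝ³ → ℝ) (G : ℝ → ℝ³ → ℝ³ →L[ℝ] ℝ³), 0 < C ∧
      IsSuitableWeakSolutionOn 𝕊 1 0 u p ∧ HasWeakSpatialGradientOn 𝕊 u G ∧
      typeIBound (Iio (0 : ℝ) ×ˢ univ) u p G < ⊤ ∧ HasTypeIDecay C u ∧ IsBackwardSingularPoint u 0 :=
  scarRigidity_or_exists_singular_apex.resolve_left h

/-! ## §2 Load-bearing hypotheses

### (A⁺) The Navier–Stokes equations -/

/-- The crux with the two Navier–Stokes hypotheses deleted (everything else verbatim). -/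
def ScarRigidityWithoutNavierStokes : Prop :=
  ∀ (u₁ : ℝ → ℝ³ → ℝ³) (p₁ : ℝ → ℝ³ → ℝ) (G₁ : ℝ → ℝ³ → ℝ³ →L[ℝ] ℝ³)
    (u₂ : ℝ → ℝ³ → ℝ³) (p₂ : ℝ → ℝ³ → ℝ) (G₂ : ℝ → ℝ³ → ℝ³ →L[ℝ] ℝ³) (C : ℝ),
    HasWeakSpatialGradientOn 𝕊 u₁ G₁ → typeIBound (Iio (0 : ℝ) ×ˢ univ) u₁ p₁ G₁ < ⊤ →
    HasTypeIDecay C u₁ →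
    HasWeakSpatialGradientOn 𝕊 u₂ G₂ → typeIBound (Iio (0 : ℝ) ×ˢ univ) u₂ p₂ G₂ < ⊤ →
    HasTypeIDecay C u₂ →
    IsBackwardSingularPoint u₁ 0 → IsBackwardSingularPoint u₂ 0 →
    SameScar u₁ u₂ → AeEqSlab u₁ u₂

/-- **(A⁺) The equations are load-bearing, even inside the full A–B class**: the kinematic bump
`χ(|x|²/(−t))/√(−t) e₀` and its negative (`ScarNonuniquenessWitnesses`). [folklore] -/
theorem scarRigidity_false_without_navierStokes : ¬ ScarRigidityWithoutNavierStokes := by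
  intro h
  obtain ⟨C, u₁, u₂, G₁, G₂, hg₁, hI₁, hd₁, hsing₁, hg₂, hI₂, hd₂, hsing₂, hscar, hne⟩ :=
    exists_sameScar_apex_singular_kinematic_not_aeEq_slab
  exact hne (h u₁ 0 G₁ u₂ 0 G₂ C hg₁ hI₁ hd₁ hg₂ hI₂ hd₂ hsing₁ hsing₂ hscar)

/-! ### (B⁺) Decay at spatial infinity — the rate and the singularity do not exclude drifts -/

/-- The crux with the apex bound weakened to the Type-I RATE and `𝐈 < ∞` dropped (Navier–Stokes, weak
gradients, both singular origins, same scar kept verbatim). -/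
def ScarRigidityRateWithoutMorrey : Prop :=
  ∀ (u₁ : ℝ → ℝ³ → ℝ³) (p₁ : ℝ → ℝ³ → ℝ) (G₁ : ℝ → ℝ³ → ℝ³ →L[ℝ] ℝ³)
    (u₂ : ℝ → ℝ³ → ℝ³) (p₂ : ℝ → ℝ³ → ℝ) (G₂ : ℝ → ℝ³ → ℝ³ →L[ℝ] ℝ³) (C : ℝ),
    IsSuitableWeakSolutionOn 𝕊 1 0 u₁ p₁ → HasWeakSpatialGradientOn 𝕊 u₁ G₁ → HasTypeITimeDecay C u₁ →
    IsSuitableWeakSolutionOn 𝕊 1 0 u₂ p₂ → HasWeakSpatialGradientOn 𝕊 u₂ G₂ → HasTypeITimeDecay C u₂ →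
    IsBackwardSingularPoint u₁ 0 → IsBackwardSingularPoint u₂ 0 →
    SameScar u₁ u₂ → AeEqSlab u₁ u₂

/-- **(B⁺) Spatial decay is load-bearing even for genuinely singular Navier–Stokes pairs**: the parasitic
drifts `(1/√−t)e₀` and `(1/√−t + (−t)/(1+t²))e₀` (`ScarNonuniquenessWitnesses`; KNSS 2009 §1).
[cite: KNSS2009, §1] -/
theorem scarRigidity_false_rate_without_morrey : ¬ ScarRigidityRateWithoutMorrey := by
  intro h
  obtain ⟨C, u₁, u₂, p₁, p₂, G₁, G₂, hs₁, hg₁, hd₁, hsing₁, hs₂, hg₂, hd₂, hsing₂, hscar, hne⟩ :=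
    ScarWitness.exists_sameScar_rate_singular_not_aeEq_slab
  exact hne (h u₁ p₁ G₁ u₂ p₂ G₂ C hs₁ hg₁ hd₁ hs₂ hg₂ hd₂ hsing₁ hsing₂ hscar)

/-! ### (B) Decay and singularity dropped together (cycle 1, landed as `UniformDriftBackwardNonuniqueness`) -/

/-- The crux with `𝐈 < ∞`, the apex bound and both singularity hypotheses deleted. -/
def ScarRigidityWithoutDecay : Prop :=
  ∀ (u₁ : ℝ → ℝ³ → ℝ³) (p₁ : ℝ → ℝ³ → ℝ) (G₁ : ℝ → ℝ³ → ℝ³ →L[ℝ] ℝ³)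
    (u₂ : ℝ → ℝ³ → ℝ³) (p₂ : ℝ → ℝ³ → ℝ) (G₂ : ℝ → ℝ³ → ℝ³ →L[ℝ] ℝ³),
    IsSuitableWeakSolutionOn 𝕊 1 0 u₁ p₁ → HasWeakSpatialGradientOn 𝕊 u₁ G₁ →
    IsSuitableWeakSolutionOn 𝕊 1 0 u₂ p₂ → HasWeakSpatialGradientOn 𝕊 u₂ G₂ →
    SameScar u₁ u₂ → AeEqSlab u₁ u₂

/-- **(B)** backward uniqueness from the scar FAILS on the whole slab without decay: `0` vs the Galilean
drift `t e` (Lei–Yang–Yuan 2024, Example 1.2).  [cite: LeiYangYuan2024, Example 1.2] -/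
theorem scarRigidity_false_without_decay : ¬ ScarRigidityWithoutDecay := by
  intro h
  obtain ⟨u₁, u₂, p₁, p₂, G₁, G₂, hs₁, hg₁, hs₂, hg₂, hscar, hne⟩ := exists_sameScar_not_aeEq_slab
  exact hne (h u₁ p₁ G₁ u₂ p₂ G₂ hs₁ hg₁ hs₂ hg₂ hscar)

/-! ### (D) Locality (cycle 1, landed): the crux is NOT a local statement -/

/-- LOCAL FORM of the crux on the parabolic cylinder `Q_R(0,0)`: suitable weak solutions there with the
apex bound there and the same scar coincide a.e. there. -/
def ScarRigidityOnCylinder (R : ℝ) : Prop :=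
  ∀ (u₁ : ℝ → ℝ³ → ℝ³) (p₁ : ℝ → ℝ³ → ℝ) (G₁ : ℝ → ℝ³ → ℝ³ →L[ℝ] ℝ³)
    (u₂ : ℝ → ℝ³ → ℝ³) (p₂ : ℝ → ℝ³ → ℝ) (G₂ : ℝ → ℝ³ → ℝ³ →L[ℝ] ℝ³) (C : ℝ),
    IsSuitableWeakSolutionOn (parabolicCylinderOpens R (0 : ℝ × ℝ³)) 1 0 u₁ p₁ →
    HasWeakSpatialGradientOn (parabolicCylinderOpens R (0 : ℝ × ℝ³)) u₁ G₁ →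
    (∀ z ∈ parabolicCylinder R (0 : ℝ × ℝ³), ‖u₁ z.1 z.2‖ ≤ C / (‖z.2‖ + Real.sqrt (-z.1))) →
    IsSuitableWeakSolutionOn (parabolicCylinderOpens R (0 : ℝ × ℝ³)) 1 0 u₂ p₂ →
    HasWeakSpatialGradientOn (parabolicCylinderOpens R (0 : ℝ × ℝ³)) u₂ G₂ →
    (∀ z ∈ parabolicCylinder R (0 : ℝ × ℝ³), ‖u₂ z.1 z.2‖ ≤ C / (‖z.2‖ + Real.sqrt (-z.1))) →
    SameScar u₁ u₂ →
    uncurry u₁ =ᵐ[volume.restrict (parabolicCylinder R (0 : ℝ × ℝ³))] uncurry u₂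

/-- **(D)** the local form fails on EVERY cylinder (`0` vs the drift `t e`, apex constant `2R³`).
[folklore] -/
theorem scarRigidity_false_local {R : ℝ} (hR : 0 < R) : ¬ ScarRigidityOnCylinder R := by
  intro h
  obtain ⟨C, u₁, u₂, p₁, p₂, G₁, G₂, hs₁, hg₁, hd₁, hs₂, hg₂, hd₂, hscar, hne⟩ :=
    exists_sameScar_typeI_not_aeEq_cylinder hR
  exact hne (h u₁ p₁ G₁ u₂ p₂ G₂ C hs₁ hg₁ hd₁ hs₂ hg₂ hd₂ hscar)

/-! ### (C), (C″) The parabolic core is load-bearing (cycle 1, landed) -/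

/-- EXTERIOR FORM of the crux on the parabolic exterior `Ω_R = {R√(−t) < ‖x‖}` (`{|y| > R} × ℝ_s` in
similarity variables) at apex constant `C`. -/
def ScarRigidityOnParabolicExterior (R C : ℝ) : Prop :=
  ∀ (u₁ : ℝ → ℝ³ → ℝ³) (p₁ : ℝ → ℝ³ → ℝ) (G₁ : ℝ → ℝ³ → ℝ³ →L[ℝ] ℝ³)
    (u₂ : ℝ → ℝ³ → ℝ³) (p₂ : ℝ → ℝ³ → ℝ) (G₂ : ℝ → ℝ³ → ℝ³ →L[ℝ] ℝ³),
    IsSuitableWeakSolutionOn (parabolicExteriorOpens R) 1 0 u₁ p₁ →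
    HasWeakSpatialGradientOn (parabolicExteriorOpens R) u₁ G₁ →
    (∀ z ∈ parabolicExterior R, ‖u₁ z.1 z.2‖ ≤ C / (‖z.2‖ + Real.sqrt (-z.1))) →
    IsSuitableWeakSolutionOn (parabolicExteriorOpens R) 1 0 u₂ p₂ →
    HasWeakSpatialGradientOn (parabolicExteriorOpens R) u₂ G₂ →
    (∀ z ∈ parabolicExterior R, ‖u₂ z.1 z.2‖ ≤ C / (‖z.2‖ + Real.sqrt (-z.1))) →
    SameScar u₁ u₂ →
    uncurry u₁ =ᵐ[volume.restrict (parabolicExterior R)] uncurry u₂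

/-- **(C)** the exterior form fails for EVERY `R ≥ 1` and EVERY `C > 0` (`0` vs the potential flow
`C√(−t)∇Γ(x)` = stationary similarity mode `W = C∇Γ(y)`; Serrin 1962).  No smallness threshold off the
core, in contrast with the whole-slab crux whose `C < ε₀` slices are vacuous. [cite: Serrin1962] -/
theorem scarRigidity_false_parabolicExterior {R C : ℝ} (hR : 1 ≤ R) (hC : 0 < C) :
    ¬ ScarRigidityOnParabolicExterior R C := by
  intro h
  obtain ⟨u₁, u₂, p₁, p₂, G₁, G₂, hs₁, hg₁, hd₁, hs₂, hg₂, hd₂, hscar, hne⟩ :=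
    exists_sameScar_typeI_not_aeEq_parabolicExterior hR hC
  exact hne (h u₁ p₁ G₁ u₂ p₂ G₂ hs₁ hg₁ hd₁ hs₂ hg₂ hd₂ hscar)

/-- EXTERIOR FORM INSIDE THE DECAY CLASS `‖u‖ ≤ C(−t)/(π‖x‖³)` (similarity `|W| ≤ C/(π|y|³)`, the rate
the route's foreseen `DifferenceDecay` step would deliver). -/
def ScarRigidityOnParabolicExteriorCubicDecay (R C : ℝ) : Prop :=
  ∀ (u₁ : ℝ → ℝ³ → ℝ³) (p₁ : ℝ → ℝ³ → ℝ) (u₂ : ℝ → ℝ³ → ℝ³) (p₂ : ℝ → ℝ³ → ℝ),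
    IsSuitableWeakSolutionOn (parabolicExteriorOpens R) 1 0 u₁ p₁ →
    (∀ z ∈ parabolicExterior R, ‖u₁ z.1 z.2‖ ≤ C / (‖z.2‖ + Real.sqrt (-z.1))) →
    (∀ z ∈ parabolicExterior R, ‖u₁ z.1 z.2‖ ≤ C / (Real.pi * ‖z.2‖ ^ 3) * (-z.1)) →
    IsSuitableWeakSolutionOn (parabolicExteriorOpens R) 1 0 u₂ p₂ →
    (∀ z ∈ parabolicExterior R, ‖u₂ z.1 z.2‖ ≤ C / (‖z.2‖ + Real.sqrt (-z.1))) →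
    (∀ z ∈ parabolicExterior R, ‖u₂ z.1 z.2‖ ≤ C / (Real.pi * ‖z.2‖ ^ 3) * (-z.1)) →
    SameScar u₁ u₂ →
    uncurry u₁ =ᵐ[volume.restrict (parabolicExterior R)] uncurry u₂

/-- **(C″)** the exterior form fails even in the cubic decay class: `0` vs the dipole-moment flow
`C(−t)∇(∂ₑΓ)(x)` (the `l = 1` Serrin mode; on paper every `2^l`-pole `(−t)^{(l+1)/2}∇(r^{−l−1}Y_lm)`).
Hence NO decay-rate hypothesis repairs an exterior Rellich lemma. [cite: Serrin1962] -/
theorem scarRigidity_false_parabolicExterior_cubicDecay {R C : ℝ} (hR : 1 ≤ R) (hC : 0 < C) :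
    ¬ ScarRigidityOnParabolicExteriorCubicDecay R C := by
  intro h
  obtain ⟨e, _, hs₁, hs₂, hd, hd', hscar, hne⟩ :=
    exists_sameScar_typeI_cubicDecay_not_aeEq_parabolicExterior hR hC
  have hz1 : ∀ z ∈ parabolicExterior R, ‖quadFlow 0 e z.1 z.2‖ ≤ C / (‖z.2‖ + Real.sqrt (-z.1)) := by
    intro z hz
    refine le_trans ?_ (hd z hz)
    simp [quadFlow_zero]
  have hz2 : ∀ z ∈ parabolicExterior R, ‖quadFlow 0 e z.1 z.2‖ ≤ C / (Real.pi * ‖z.2‖ ^ 3) * (-z.1) := by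
    intro z hz
    refine le_trans ?_ (hd' z hz)
    simp [quadFlow_zero]
  exact hne (h _ _ _ _ hs₁ hz1 hz2 hs₂ hd hd' hscar)

end Summit.NavierStokesRegularity.NavierStokesRegularity.Theorems.ScarRigidity.Negative

end
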